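import Summits.QuantumFields.QCD.Theorems.HeatSlicedQuarksQuarkLoopCoefficientSecondOrderExpansionAuxC
import Summits.QuantumFields.QCD.Theorems.HeatSlicedQuarksQuarkLoopCoefficientSymmetricGauge

/-!
# Second-order expansion of the heat symbol — part H: the twisted generator and the ODE of `E₁`
(line `Sketch` of crux stmt-QuantumFields-16786, stub `stub_secondOrderExpansion`, helper file)

* The twisted generator `(V_θ f)(w) = Σ_{v ∈ nbr2 0} Ω_θ(v,w) • (ȟ_θ(v) f(w−v))` of the evolution
  `∂_t E = −V_θ E` of the symmetric-gauge heat symbol (`ȟ_θ = sqKer (symLink θ) 0`): its double-sum form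
  with the total phase `e^{i(θ/2)(z∧v + v∧w)}`, its value `V_0 = vtx 0` at zero flux, linearity, and
  the **cocycle remainder bound**
  `‖(V_θ f − Σ_{j<m} θʲ vtx j f)(w)_{αβ}‖ ≤ 20736 (2|θ|(1+|w|))ᵐ Σ_v F(w−v)`.
* Time derivatives of the free kernel and of `E₀ = pert0`, `E₁ = pert1` (closed form of part C):
  `∂_s E₁ = −vtx 0 E₁ − vtx 1 E₀`, entrywise, for `s > 0`; continuity of their entries.
-/

noncomputable section

namespace Summit.QuantumFields.QCD.Cruxes.QuarkLoopCoefficient.Sketch.SecondOrderExpansion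

open Literature.MathematicalPhysics.QuantumLattice Literature.MathematicalPhysics.QuantumFieldTheory
open Literature.Probability.LatticeModels (Site)
open Summit.QuantumFields.QCD.Theorems.QuarkLoopCoefficient
open Summit.QuantumFields.QCD.Cruxes.QuarkLoopCoefficient.Sketch.HeatSeries
open Summit.QuantumFields.QCD.Cruxes.QuarkLoopCoefficient.Sketch.FreeMajorantToolkit
open Summit.QuantumFields.QCD.Cruxes.QuarkLoopCoefficient.Sketch.SymmetricGauge
open scoped Matrix ComplexConjugate

/-- The first-order matrix kernel `η(v) = Σ_{z ∈ nbr 0} (z∧v) • ď♯(z) ď(v−z)` (local notation). -/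
local notation "η[" v "]" => (∑ z ∈ nbr 0, ((wedge z v : ℤ) : ℂ) • (dsharp z * dsymb (v - z)))

/-- The twisted generator `(V_θ f)(w) = Σ_{v ∈ nbr2 0} Ω_θ(v, w) • (ȟ_θ(v) f(w − v))` (local notation). -/
local notation "V[" θ "]" => (fun (f : Site 4 → Spin) (w : Site 4) =>
  ∑ v ∈ nbr2 0, Complex.exp (((θ / 2 * (wedge v w : ℤ) : ℝ) : ℂ) * Complex.I) • (sqKer (symLink θ) 0 v * f (w - v)))

/-! ## §17 The twisted generator -/

/-- **Double-sum form of the twisted generator**: the two phases combine into the total phase of the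
vertex, `(V_θ f)(w) = Σ_{v,z} e^{i(θ/2)(z∧v + v∧w)} • (ď♯(z) ď(v−z) f(w−v))`. -/
theorem twistedGen_eq_sum_sum (θ : ℝ) (f : Site 4 → Spin) (w : Site 4) :
    V[θ] f w = ∑ v ∈ nbr2 0, ∑ z ∈ nbr 0,
      Complex.exp (((θ / 2 * (wedge z v + wedge v w : ℤ) : ℝ) : ℂ) * Complex.I) •
        (dsharp z * dsymb (v - z) * f (w - v)) := by
  simp only
  refine Finset.sum_congr rfl fun v _ => ?_
  rw [sqKer_symLink_zero, Finset.sum_mul, Finset.smul_sum]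
  refine Finset.sum_congr rfl fun z _ => ?_
  rw [smul_mul_assoc, smul_smul, ← Complex.exp_add]
  congr 2
  push_cast; ring

/-- At zero flux the twisted generator is the order-zero vertex: `V_0 = vtx 0`. -/
theorem twistedGen_zero (f : Site 4 → Spin) (w : Site 4) : V[0] f w = vtx 0 f w := by
  rw [twistedGen_eq_sum_sum]
  unfold vtx
  refine Finset.sum_congr rfl fun v _ => Finset.sum_congr rfl fun z _ => ?_
  simp

/-- Linearity of the twisted generator: subtraction. -/
theorem twistedGen_sub (θ : ℝ) (f g : Site 4 → Spin) (w : Site 4) :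
    V[θ] (fun y => f y - g y) w = V[θ] f w - V[θ] g w := by
  simp only [Matrix.mul_sub, smul_sub, Finset.sum_sub_distrib]

/-- Linearity of the twisted generator: scalar multiples. -/
theorem twistedGen_smul (θ : ℝ) (c : ℂ) (f : Site 4 → Spin) (w : Site 4) :
    V[θ] (fun y => c • f y) w = c • V[θ] f w := by
  simp only [Matrix.mul_smul, Finset.smul_sum]
  refine Finset.sum_congr rfl fun v _ => ?_
  rw [smul_comm]

/-- **Cocycle remainder bound**: for a field `f` with entries `‖f(y)_{γδ}‖ ≤ F(y)`,
`‖(V_θ f − Σ_{j<m} θʲ vtx j f)(w)_{αβ}‖ ≤ 20736 (2|θ|(1+|w|))ᵐ Σ_{v ∈ nbr2 0} F(w − v)`. -/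
theorem norm_twistedGen_sub_sum_vtx_apply_le (θ : ℝ) {f : Site 4 → Spin} {F : Site 4 → ℝ}
    (hF : ∀ y α β, ‖f y α β‖ ≤ F y) (m : ℕ) (w : Site 4) (α β : Fin 4) :
    ‖(V[θ] f w - ∑ j ∈ Finset.range m, (θ : ℂ) ^ j • vtx j f w) α β‖ ≤
      20736 * (2 * |θ| * (1 + elen w)) ^ m * ∑ v ∈ nbr2 0, F (w - v) := by
  have hrew : V[θ] f w - ∑ j ∈ Finset.range m, (θ : ℂ) ^ j • vtx j f w =
      ∑ v ∈ nbr2 0, ∑ z ∈ nbr 0,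
        (Complex.exp (((θ / 2 * (wedge z v + wedge v w : ℤ) : ℝ) : ℂ) * Complex.I) -
          ∑ j ∈ Finset.range m, (θ : ℂ) ^ j *
            ((Complex.I / 2 * ((wedge z v + wedge v w : ℤ) : ℂ)) ^ j / (j.factorial : ℂ))) •
          (dsharp z * dsymb (v - z) * f (w - v)) := by
    rw [twistedGen_eq_sum_sum]
    unfold vtx
    simp only [Finset.smul_sum, smul_smul, sub_smul, Finset.sum_sub_distrib, Finset.sum_smul]
    congr 1
    rw [Finset.sum_comm]
    refine Finset.sum_congr rfl fun v _ => ?_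
    rw [Finset.sum_comm]
  rw [hrew]
  have he := elen_nonneg w
  exact norm_weightedVertex_apply_le (by positivity) (fun z hz v hv => norm_cocycleRemainder_le hz hv θ w m) hF w α β

/-! ## §18 Time derivatives of the free kernel, of `E₀` and of `E₁` -/

/-- The free heat equation, complex form: `∂_s k_s(x) = −Σ_z ĥ(z) k_s(x − z)`. -/
theorem hasDerivAt_freeKer_ofReal
    (h4 : ∀ (t : ℝ) (w : Site 4),
      HasDerivAt (fun s => freeKer s w) (-(∑ z ∈ nbr2 0, hhat z * freeKer t (w - z))) t)
    (s : ℝ) (x : Site 4) :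
    HasDerivAt (fun r : ℝ => ((freeKer r x : ℝ) : ℂ))
      (-(((∑ z ∈ nbr2 0, hhat z * freeKer s (x - z) : ℝ)) : ℂ)) s := by
  have := (h4 s x).ofReal_comp
  simpa using this

/-- The free kernel is continuous in time. -/
theorem continuous_freeKer_of_hasDerivAt
    (h4 : ∀ (t : ℝ) (w : Site 4),
      HasDerivAt (fun s => freeKer s w) (-(∑ z ∈ nbr2 0, hhat z * freeKer t (w - z))) t)
    (x : Site 4) : Continuous fun s : ℝ => freeKer s x :=
  continuous_iff_continuousAt.mpr fun s => (h4 s x).continuousAt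

/-- The order-zero vertex on the free kernel is scalar: `vtx 0 (pert0 s) w = (Σ_z ĥ(z) k_s(w−z)) • 1`. -/
theorem vtx_zero_pert0
    (h1 : ∀ x y : Site 4, sqKer (fun _ => (1 : ℂ)) x y = ((hhat (y - x) : ℝ) : ℂ) • (1 : Spin))
    (s : ℝ) (w : Site 4) :
    vtx 0 (pert0 s) w = (((∑ z ∈ nbr2 0, hhat z * freeKer s (w - z) : ℝ)) : ℂ) • (1 : Spin) := by
  rw [vtx_zero_apply, Complex.ofReal_sum, Finset.sum_smul]
  refine Finset.sum_congr rfl fun v _ => ?_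
  rw [h1, sub_zero, pert0, Matrix.smul_mul, Matrix.one_mul, smul_smul]
  push_cast
  rfl

/-- **ODE of `E₀`**: `∂_s (pert0 s w)_{αβ} = −(vtx 0 (pert0 s) w)_{αβ}`. -/
theorem hasDerivAt_pert0_apply
    (h1 : ∀ x y : Site 4, sqKer (fun _ => (1 : ℂ)) x y = ((hhat (y - x) : ℝ) : ℂ) • (1 : Spin))
    (h4 : ∀ (t : ℝ) (w : Site 4),
      HasDerivAt (fun s => freeKer s w) (-(∑ z ∈ nbr2 0, hhat z * freeKer t (w - z))) t)
    (s : ℝ) (w : Site 4) (α β : Fin 4) :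
    HasDerivAt (fun r : ℝ => pert0 r w α β) (-(vtx 0 (pert0 s) w) α β) s := by
  have hfun : (fun r : ℝ => pert0 r w α β) = fun r : ℝ => ((freeKer r w : ℝ) : ℂ) * (if α = β then 1 else 0) := by
    funext r; simp [pert0, Matrix.one_apply]
  rw [hfun]
  have h := (hasDerivAt_freeKer_ofReal h4 s w).mul_const (if α = β then (1 : ℂ) else 0)
  refine h.congr_deriv ?_
  rw [vtx_zero_pert0 h1 s w]
  simp only [Matrix.smul_apply, Matrix.one_apply, smul_eq_mul, mul_ite, mul_one, mul_zero]
  split_ifs <;> simp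

/-- Continuity of the entries of `E₀`. -/
theorem continuous_pert0_apply
    (h4 : ∀ (t : ℝ) (w : Site 4),
      HasDerivAt (fun s => freeKer s w) (-(∑ z ∈ nbr2 0, hhat z * freeKer t (w - z))) t)
    (w : Site 4) (α β : Fin 4) : Continuous fun s : ℝ => pert0 s w α β := by
  have hfun : (fun r : ℝ => pert0 r w α β) = fun r : ℝ => ((freeKer r w : ℝ) : ℂ) * (if α = β then 1 else 0) := by
    funext r; simp [pert0, Matrix.one_apply]
  rw [hfun]
  exact (Complex.continuous_ofReal.comp (continuous_freeKer_of_hasDerivAt h4 w)).mul continuous_const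

/-- The derivative of the closed form of `E₁`, entrywise. -/
theorem hasDerivAt_pert1Closed_apply
    (h4 : ∀ (t : ℝ) (w : Site 4),
      HasDerivAt (fun s => freeKer s w) (-(∑ z ∈ nbr2 0, hhat z * freeKer t (w - z))) t)
    (s : ℝ) (w : Site 4) (α β : Fin 4) :
    HasDerivAt (fun r : ℝ => (-((r : ℂ) • ∑ v ∈ nbr2 0, (Complex.I / 2 * ((freeKer r (w - v) : ℝ) : ℂ)) • η[v])) α β)
      ((-(∑ v ∈ nbr2 0, (Complex.I / 2 * ((freeKer s (w - v) : ℝ) : ℂ)) • η[v]) +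
        (s : ℂ) • ∑ v ∈ nbr2 0, (Complex.I / 2 *
          (((∑ z ∈ nbr2 0, hhat z * freeKer s (w - v - z) : ℝ)) : ℂ)) • η[v]) α β) s := by
  -- write the entry as `−(r * Σ_v (i/2) k_r(w−v) * η(v)_{αβ})`
  have hfun : (fun r : ℝ => (-((r : ℂ) • ∑ v ∈ nbr2 0, (Complex.I / 2 * ((freeKer r (w - v) : ℝ) : ℂ)) • η[v])) α β) =
      fun r : ℝ => -((r : ℂ) * ∑ v ∈ nbr2 0, Complex.I / 2 * ((freeKer r (w - v) : ℝ) : ℂ) * (η[v]) α β) := by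
    funext r
    simp only [Matrix.neg_apply, Matrix.smul_apply, Matrix.sum_apply, smul_eq_mul]
  rw [hfun]
  have hlin : HasDerivAt (fun r : ℝ => (r : ℂ)) 1 s := by
    simpa using (hasDerivAt_id s).ofReal_comp
  have hsum : HasDerivAt (fun r : ℝ => ∑ v ∈ nbr2 0, Complex.I / 2 * ((freeKer r (w - v) : ℝ) : ℂ) * (η[v]) α β)
      (∑ v ∈ nbr2 0, Complex.I / 2 * (-(((∑ z ∈ nbr2 0, hhat z * freeKer s (w - v - z) : ℝ)) : ℂ)) * (η[v]) α β) s := by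
    refine HasDerivAt.fun_sum fun v _ => ?_
    exact ((hasDerivAt_freeKer_ofReal h4 s (w - v)).const_mul (Complex.I / 2)).mul_const _
  have h := (hlin.mul hsum).neg
  refine h.congr_deriv ?_
  simp only [Matrix.add_apply, Matrix.neg_apply, Matrix.smul_apply, Matrix.sum_apply, smul_eq_mul, one_mul,
    Finset.mul_sum, neg_add, ← Finset.sum_neg_distrib]
  congr 1
  refine Finset.sum_congr rfl fun v _ => ?_
  ring

/-- **ODE of `E₁`** (closed form): for `s > 0`,
`∂_s (pert1 s w)_{αβ} = (−vtx 0 (pert1 s) w − vtx 1 (pert0 s) w)_{αβ}`. -/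
theorem hasDerivAt_pert1_apply
    (h1 : ∀ x y : Site 4, sqKer (fun _ => (1 : ℂ)) x y = ((hhat (y - x) : ℝ) : ℂ) • (1 : Spin))
    (h3 : ∀ w : Site 4, freeKer 0 w = if w = 0 then 1 else 0)
    (h4 : ∀ (t : ℝ) (w : Site 4),
      HasDerivAt (fun s => freeKer s w) (-(∑ z ∈ nbr2 0, hhat z * freeKer t (w - z))) t)
    (h5 : ∀ s r : ℝ, 0 ≤ s → 0 ≤ r → ∀ w : Site 4,
      HasSum (fun y : Site 4 => freeKer s y * freeKer r (w - y)) (freeKer (s + r) w))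
    (h6 : ∀ t : ℝ, 0 ≤ t → ∀ (w : Site 4) (ν : Fin 4),
      t * (∑ z ∈ nbr2 0, ((z ν : ℤ) : ℝ) * hhat z * freeKer t (w - z)) + ((w ν : ℤ) : ℝ) * freeKer t w = 0)
    {s : ℝ} (hs : 0 < s) (w : Site 4) (α β : Fin 4) :
    HasDerivAt (fun r : ℝ => pert1 r w α β) ((-(vtx 0 (pert1 s) w) - vtx 1 (pert0 s) w) α β) s := by
  -- `pert1` agrees with its closed form on the open half-line `(0, ∞) ∋ s`
  have hev : (fun r : ℝ => pert1 r w α β) =ᶠ[nhds s]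
      fun r : ℝ => (-((r : ℂ) • ∑ v ∈ nbr2 0, (Complex.I / 2 * ((freeKer r (w - v) : ℝ) : ℂ)) • η[v])) α β := by
    filter_upwards [Ioi_mem_nhds hs] with r hr
    rw [pert1_eq h1 h3 h5 h6 (le_of_lt hr) w]
  refine ((hasDerivAt_pert1Closed_apply h4 s w α β).congr_of_eventuallyEq hev).congr_deriv ?_
  -- identify the derivative with `−vtx0 E₁ − vtx1 E₀`
  have hp : ∀ x : Site 4, pert1 s x = -((s : ℂ) • ∑ u ∈ nbr2 0,
      (Complex.I / 2 * ((freeKer s (x - u) : ℝ) : ℂ)) • η[u]) := fun x => pert1_eq h1 h3 h5 h6 hs.le x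
  have hv0 : vtx 0 (pert1 s) w = -((s : ℂ) • ∑ u ∈ nbr2 0, (Complex.I / 2 *
      (((∑ z ∈ nbr2 0, hhat z * freeKer s (w - u - z) : ℝ)) : ℂ)) • η[u]) := by
    rw [vtx_zero_apply]
    calc ∑ v ∈ nbr2 0, sqKer (fun _ => (1 : ℂ)) 0 v * pert1 s (w - v)
        = ∑ v ∈ nbr2 0, ∑ u ∈ nbr2 0,
            (-(((hhat v : ℝ) : ℂ) * ((s : ℂ) * (Complex.I / 2 * ((freeKer s (w - v - u) : ℝ) : ℂ))))) • η[u] := by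
          refine Finset.sum_congr rfl fun v _ => ?_
          rw [h1, sub_zero, Matrix.smul_mul, Matrix.one_mul, hp, smul_neg, Finset.smul_sum, Finset.smul_sum,
            ← Finset.sum_neg_distrib]
          refine Finset.sum_congr rfl fun u _ => ?_
          rw [smul_smul, smul_smul, neg_smul, mul_assoc]
      _ = ∑ u ∈ nbr2 0, ∑ v ∈ nbr2 0,
            (-(((hhat v : ℝ) : ℂ) * ((s : ℂ) * (Complex.I / 2 * ((freeKer s (w - v - u) : ℝ) : ℂ))))) • η[u] :=
          Finset.sum_comm
      _ = _ := by
          rw [Finset.smul_sum, ← Finset.sum_neg_distrib]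
          refine Finset.sum_congr rfl fun u _ => ?_
          rw [← Finset.sum_smul, smul_smul, ← neg_smul]
          congr 1
          rw [Complex.ofReal_sum, Finset.mul_sum, Finset.mul_sum, ← Finset.sum_neg_distrib]
          refine Finset.sum_congr rfl fun z _ => ?_
          rw [sub_right_comm w u z]
          push_cast; ring
  rw [hv0, vtx_one_pert0 h1 h3 h6 hs.le w, neg_neg]
  exact congrFun (congrFun (by abel) α) β

/-- Continuity of the entries of `E₁` on `[0, ∞)`. -/
theorem continuousOn_pert1_apply
    (h1 : ∀ x y : Site 4, sqKer (fun _ => (1 : ℂ)) x y = ((hhat (y - x) : ℝ) : ℂ) • (1 : Spin))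
    (h3 : ∀ w : Site 4, freeKer 0 w = if w = 0 then 1 else 0)
    (h4 : ∀ (t : ℝ) (w : Site 4),
      HasDerivAt (fun s => freeKer s w) (-(∑ z ∈ nbr2 0, hhat z * freeKer t (w - z))) t)
    (h5 : ∀ s r : ℝ, 0 ≤ s → 0 ≤ r → ∀ w : Site 4,
      HasSum (fun y : Site 4 => freeKer s y * freeKer r (w - y)) (freeKer (s + r) w))
    (h6 : ∀ t : ℝ, 0 ≤ t → ∀ (w : Site 4) (ν : Fin 4),
      t * (∑ z ∈ nbr2 0, ((z ν : ℤ) : ℝ) * hhat z * freeKer t (w - z)) + ((w ν : ℤ) : ℝ) * freeKer t w = 0)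
    (w : Site 4) (α β : Fin 4) : ContinuousOn (fun s : ℝ => pert1 s w α β) (Set.Ici 0) := by
  have hcl : Continuous fun r : ℝ =>
      (-((r : ℂ) • ∑ v ∈ nbr2 0, (Complex.I / 2 * ((freeKer r (w - v) : ℝ) : ℂ)) • η[v])) α β := by
    simp only [Matrix.neg_apply, Matrix.smul_apply, Matrix.sum_apply, smul_eq_mul]
    refine (Complex.continuous_ofReal.mul (continuous_finsetSum _ fun v _ => ?_)).neg
    exact ((continuous_const.mul (Complex.continuous_ofReal.comp (continuous_freeKer_of_hasDerivAt h4 (w - v))))).mul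
      continuous_const
  refine hcl.continuousOn.congr fun s hs => ?_
  rw [pert1_eq h1 h3 h5 h6 hs w]

/-! ## Registered headline -/

/-- Registered headline of this helper file (aux stub `stub_secondOrderExpansionAuxH` of crux
stmt-QuantumFields-16786, line `Sketch`): the ODE of the first-order term `E₁ = pert1`. -/
theorem stub_secondOrderExpansionAuxH : (∀ x y : Site 4, sqKer (fun _ => (1 : ℂ)) x y = ((hhat (y - x) : ℝ) : ℂ) • (1 : Spin)) → (∀ w : Site 4, freeKer 0 w = if w = 0 then 1 else 0) → (∀ (t : ℝ) (w : Site 4), HasDerivAt (fun s => freeKer s w) (-(∑ z ∈ nbr2 0, hhat z * freeKer t (w - z))) t) → (∀ s r : ℝ, 0 ≤ s → 0 ≤ r → ∀ w : Site 4, HasSum (fun y : Site 4 => freeKer s y * freeKer r (w - y)) (freeKer (s + r) w)) → (∀ t : ℝ, 0 ≤ t → ∀ (w : Site 4) (ν : Fin 4), t * (∑ z ∈ nbr2 0, ((z ν : ℤ) : ℝ) * hhat z * freeKer t (w - z)) + ((w ν : ℤ) : ℝ) * freeKer t w = 0) → ∀ (s : ℝ), 0 < s → ∀ (w : Site 4)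 (α β : Fin 4), HasDerivAt (fun r : ℝ => pert1 r w α β) ((-(vtx 0 (pert1 s) w) - vtx 1 (pert0 s) w) α β) s :=
  fun h1 h3 h4 h5 h6 _ hs w α β => hasDerivAt_pert1_apply h1 h3 h4 h5 h6 hs w α β

end Summit.QuantumFields.QCD.Cruxes.QuarkLoopCoefficient.Sketch.SecondOrderExpansion

end
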